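import Summits.QuantumFields.YangMills.Theorems.UnitScaleTiltProp7SectET3Eq3124RowsT3
import HarnessLib

/-!
# Route `UnitScaleTilt`, crux «MinimiserStabilityRegPr» (stmt-QuantumFields-19200, stub EX `stub_existenceMinimalOrbit`, route (α)) — «EQ130-OF-128»: **[Balaban1985Variational] (128) ⇒ (129)–(130),
# GUARD-FREE, GENERIC SLOT** — from «`Δ_a A′ + x ∈ range Q*`» (criticality on `ker Q`, (128)) to «`A′ = H₀(QA′) − (G − H₀QG)x`» ((129)–(130)) by positivity of `Δ_a` alone (no `hkill`∕`horth`
# slot row, no `R_S`-multiplier) — the algebra of the S11 reshape at the slot `Δ^η` (★★OWNER RULING g28-№9; EX namer 2026-08-28T22:27:41Z «ADOPT (a)»; ym3-torus-px16 22:28:27Z caveat)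

Cell `ym3-torus` (HUMAN RULING D-0037, YM ladder rung R3 — YM₃ on T³, NOT d = 4, NOT Clay; YM gap NOT proved), width seat `ym3-torus-px21` gen 2 (explicit-unit helper; LOCATE «HMULT-127»
`ym3-torus-px21/LOCATE-HMULT-127-px21g2.md` §3).  THEOREMS ONLY (0 `def`, 0 `sorry`); `--supports stmt-QuantumFields-19200 --as helper`, count-neutral; NO claim on crux ∕ stub ∕ registry.

THE PRINT.  [Balaban1985Variational] p. 297: «(127) for all δA′ satisfying QδA′ = 0 … can be written as ⟨δA′, J⟩ + ⟨δA′, Δ_aA₁′⟩ − … = 0 (128) where Δ_a = Δ + DRD* + Q*aQ … For the operator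
Δ_a⁻¹ = G we have proved Theorem 3.3 in [5] … We decompose A₁′ = A₀ + H₀B, where H₀B is defined as a minimum of the quadratic form ½⟨A′, Δ_aA′⟩ on the subspace QA′ = B. We find easily that
H₀B is given by H₀B = GQ*(QGQ*)⁻¹B (129) … (130)».  In brick L0d's letters (✓`Prop7SectET3CurvedPropagators`, slot `Δx`): `Δ_a = laplaceA … Δx U₀`, `G = GT`, `(QGQ*)⁻¹ = KinvT`, `H₀ = HT`,
and the class `PosOnto … Δx U₀` (Thm 3.3∕3.11 positivity + `Q` onto).  NOTHING about `Δx` on the residual gauge algebra `N_S` is used — which is the point: at `Δx := DeltaEtaSlot` (print's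
`Δ_a` of (128)) the rows `hkill∕horth` are false off critical backgrounds, and print's (128) → (130) does not need them.

WHAT IS PROVED (member `F`, `K n`, `h : n ≤ K`, weights `c₀ cB`, `a`; generic slot `Δx`; ns `…Theorems.Prop7Eq130OfEq128`):
* §1 `laplaceA_HT` (`Δ_a(H₀b) = Q*((QGQ*)⁻¹b)` on the class), `eq_zero_of_laplaceA_mem_range_of_Qk_eq_zero` (UNIQUENESS: `Δ_a d ∈ range Q*`, `Q d = 0` ⇒ `d = 0`, by positivity),
  `laplaceA_add_of_landau` ((128) in the `Δx`-form + `R_S D* A′ = 0` ⇒ the `Δ_a`-form).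
* §2 ★★★**`eq130_of_eq128 (hp : PosOnto … Δx U₀) (h128 : laplaceA … Δx U₀ A + x = Qk† μ) : A = HT … (Qk … A) − (GT … x − HT … (Qk … (GT … x)))`** — (129)–(130): `A′ = H₀(QA′) − 𝔊₀x`,
  `𝔊₀ := G − H₀QG`; and ★★`eq130_of_eq128_landau` (from the `Δx`-form `Δx U₀ A + D R_S D* … + … `: `R_S D* A = 0` and `Δx U₀ A + x = Qk† μ` ⇒ the same).
HONEST SCOPE.  Linear algebra over brick L0d; no estimate; `PosOnto` displayed; not a proof of any stub; nothing continuum ∕ OS ∕ mass-gap ∕ Clay.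

References: T. Bałaban, CMP **102** (1985) 277–309 [Balaban1985Variational] ((127)–(130) p.297, (110)–(111) p.294); CMP **99** (1985) 389–434 [Balaban1985BackgroundPropagators]
((3.26)–(3.27) p.395, (3.122)–(3.126) p.420, Thm 3.3 p.399).
-/

set_option autoImplicit false

noncomputable section

open scoped InnerProductSpace ComplexConjugate Matrix.Norms.L2Operator BigOperators

namespace Summit.QuantumFields.YangMills.Theorems.Prop7Eq130OfEq128

open Literature.MathematicalPhysics.QuantumFieldTheory.Balaban1983to89
open Literature.MathematicalPhysics.QuantumFieldTheory.Balaban1983to89.T3ContinuumYM3Torus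
open B9SectCLatticeCarrier (Bond)
open B9Eq311L2Pairing (WL2)
open B11Eq103H1Complex (SiteL2K BondL2K)
open Summit.QuantumFields.YangMills.Theorems.Prop7SectET3Transport (periodsT3)
open Summit.QuantumFields.YangMills.Theorems.Prop7SectET3HilbertLetters (W₂ DL2 DstarL2)
open Summit.QuantumFields.YangMills.Theorems.Prop7SectET3GaugeProjector (RS)
open Summit.QuantumFields.YangMills.Theorems.Prop7SectET3CurvedPropagators

variable {F : T3Family} {n K : ℕ} {h : n ≤ K} {c₀ cB a : ℝ} [Fact (0 < c₀)] [Fact (0 < cB)]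
variable {Δx : GaugeField (F.P K) 0 (Matrix.specialUnitaryGroup (Fin 2) ℂ) → (BondL2K ℂ 3 (periodsT3 F K) c₀ W₂ →ₗ[ℂ] BondL2K ℂ 3 (periodsT3 F K) c₀ W₂)}

/-! ## §1 `Δ_a H₀ = Q*(QGQ*)⁻¹`, uniqueness from positivity, and the Landau reading of (128) -/

/-- **`Δ_a(H₀ b) = Q*((QGQ*)⁻¹ b)`** on the class (`H₀ = GQ*(QGQ*)⁻¹`, `Δ_aG = 1`). [cite: Balaban1985Variational, (129) p.297; Balaban1985BackgroundPropagators, (3.126) p.420] -/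
theorem laplaceA_HT {U₀ : GaugeField (F.P K) 0 (Matrix.specialUnitaryGroup (Fin 2) ℂ)} (hp : PosOnto F n K h c₀ cB a Δx U₀)
    (b : WL2 ℂ (fun _ : PBond (F.P n) 0 => cB) W₂) :
    laplaceA F n K h c₀ cB a Δx U₀ (HT F n K h c₀ cB a Δx U₀ b) = LinearMap.adjoint (Qk F n K h c₀ cB U₀) (KinvT F n K h c₀ cB a Δx U₀ b) := by
  rw [HT_eq_comp hp, LinearMap.comp_apply, LinearMap.comp_apply, laplaceA_GT hp]

/-- **UNIQUENESS FROM POSITIVITY**: if `Δ_a d = Q*ν` and `Q d = 0` then `d = 0` (`re⟪d, Δ_a d⟫ = re⟪Qd, ν⟫ = 0`, and `Δ_a > 0` on the class).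
[cite: Balaban1985Variational, (129)–(130) p.297; Balaban1985BackgroundPropagators, Thm 3.3 p.399, Thm 3.11 p.416] -/
theorem eq_zero_of_laplaceA_mem_range_of_Qk_eq_zero {U₀ : GaugeField (F.P K) 0 (Matrix.specialUnitaryGroup (Fin 2) ℂ)} (hp : PosOnto F n K h c₀ cB a Δx U₀)
    {d : BondL2K ℂ 3 (periodsT3 F K) c₀ W₂} {ν : WL2 ℂ (fun _ : PBond (F.P n) 0 => cB) W₂}
    (hd : laplaceA F n K h c₀ cB a Δx U₀ d = LinearMap.adjoint (Qk F n K h c₀ cB U₀) ν) (hQ : Qk F n K h c₀ cB U₀ d = 0) : d = 0 := by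
  by_contra hne
  have hpos := hp.pos d hne
  rw [hd, LinearMap.adjoint_inner_right, hQ, inner_zero_left, map_zero] at hpos
  exact lt_irrefl _ hpos

/-- **(128) IN THE `Δ_a`-FORM FROM THE `Δ`-FORM FOR A LANDAU FIELD**: if `R_S D* A = 0` and `Δx A + x = Q*μ` then `Δ_a A + x = Q*(μ + a·QA)` (`Δ_a = Δx + DR_SD* + Q*aQ`).
[cite: Balaban1985Variational, (128) p.297; Balaban1985BackgroundPropagators, (3.26) p.395] -/
theorem laplaceA_add_of_landau (U₀ : GaugeField (F.P K) 0 (Matrix.specialUnitaryGroup (Fin 2) ℂ)) {A x : BondL2K ℂ 3 (periodsT3 F K) c₀ W₂}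
    {μ : WL2 ℂ (fun _ : PBond (F.P n) 0 => cB) W₂} (hL : RS F n K h c₀ cB U₀ (DstarL2 F n K c₀ U₀ A) = 0)
    (h128 : Δx U₀ A + x = LinearMap.adjoint (Qk F n K h c₀ cB U₀) μ) :
    laplaceA F n K h c₀ cB a Δx U₀ A + x = LinearMap.adjoint (Qk F n K h c₀ cB U₀) (μ + ((a : ℂ)) • Qk F n K h c₀ cB U₀ A) := by
  rw [laplaceA_apply, hL, map_zero, add_zero, add_right_comm, h128, ← map_add]

/-! ## §2 ★★★ (128) ⇒ (129)–(130) -/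

/-- ★★★ **(128) ⇒ (129)–(130), GUARD-FREE, GENERIC SLOT**: on the class `PosOnto … Δx U₀`, if `Δ_a A + x = Q*μ` for some `μ` then
`A = H₀(QA) − (Gx − H₀(Q(Gx)))` — «`A₁′ = A₀ + H₀B`» with `B = QA₁′`, `A₀ = −𝔊₀x`, `𝔊₀ := G − H₀QG`.  Proof: both sides have the same `Q`-image (`QH₀ = 1`) and `Δ_a`-images differing by
an element of `range Q*` (`Δ_aG = 1`, `Δ_aH₀ = Q*(QGQ*)⁻¹`); uniqueness by positivity.  NO row about `Δx` on `N_S` is used.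
[cite: Balaban1985Variational, (128)–(130) p.297; Balaban1985BackgroundPropagators, (3.122)–(3.126) p.420] -/
theorem eq130_of_eq128 {U₀ : GaugeField (F.P K) 0 (Matrix.specialUnitaryGroup (Fin 2) ℂ)} (hp : PosOnto F n K h c₀ cB a Δx U₀)
    {A x : BondL2K ℂ 3 (periodsT3 F K) c₀ W₂} {μ : WL2 ℂ (fun _ : PBond (F.P n) 0 => cB) W₂}
    (h128 : laplaceA F n K h c₀ cB a Δx U₀ A + x = LinearMap.adjoint (Qk F n K h c₀ cB U₀) μ) :
    A = HT F n K h c₀ cB a Δx U₀ (Qk F n K h c₀ cB U₀ A)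
        - (GT F n K h c₀ cB a Δx U₀ x - HT F n K h c₀ cB a Δx U₀ (Qk F n K h c₀ cB U₀ (GT F n K h c₀ cB a Δx U₀ x))) := by
  rw [← sub_eq_zero]
  refine eq_zero_of_laplaceA_mem_range_of_Qk_eq_zero hp
    (ν := μ - KinvT F n K h c₀ cB a Δx U₀ (Qk F n K h c₀ cB U₀ A) - KinvT F n K h c₀ cB a Δx U₀ (Qk F n K h c₀ cB U₀ (GT F n K h c₀ cB a Δx U₀ x))) ?_ ?_
  · have hA : laplaceA F n K h c₀ cB a Δx U₀ A = LinearMap.adjoint (Qk F n K h c₀ cB U₀) μ - x := eq_sub_of_add_eq h128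
    rw [map_sub, map_sub, map_sub, hA, laplaceA_HT hp, laplaceA_HT hp, laplaceA_GT hp, map_sub, map_sub]
    abel
  · rw [map_sub, map_sub, map_sub, Qk_HT hp, Qk_HT hp, sub_sub_cancel, sub_self]

/-- ★★ **(128) ⇒ (129)–(130) FOR THE LANDAU SOLUTION, `Δ`-FORM**: if `R_S D* A = 0` and `Δx U₀ A + x = Q*μ` (print's (128): `⟨δ, J + ΔA′ + W⟩ = 0` on `ker Q`, read as `ΔA′ + (J + W) ∈ range Q*`)
then `A = H₀(QA) − (Gx − H₀Q(Gx))`. [cite: Balaban1985Variational, (128)–(130) p.297] -/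
theorem eq130_of_eq128_landau {U₀ : GaugeField (F.P K) 0 (Matrix.specialUnitaryGroup (Fin 2) ℂ)} (hp : PosOnto F n K h c₀ cB a Δx U₀)
    {A x : BondL2K ℂ 3 (periodsT3 F K) c₀ W₂} {μ : WL2 ℂ (fun _ : PBond (F.P n) 0 => cB) W₂}
    (hL : RS F n K h c₀ cB U₀ (DstarL2 F n K c₀ U₀ A) = 0) (h128 : Δx U₀ A + x = LinearMap.adjoint (Qk F n K h c₀ cB U₀) μ) :
    A = HT F n K h c₀ cB a Δx U₀ (Qk F n K h c₀ cB U₀ A)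
        - (GT F n K h c₀ cB a Δx U₀ x - HT F n K h c₀ cB a Δx U₀ (Qk F n K h c₀ cB U₀ (GT F n K h c₀ cB a Δx U₀ x))) :=
  eq130_of_eq128 hp (laplaceA_add_of_landau (a := a) U₀ hL h128)

/-! ## §3 The slot identity of the solution at a guard-free slot: NO `R_S`-multiplier -/

/-- ★★★ **THE SLOT IDENTITY AT A GUARD-FREE SLOT (e.g. `Δ^η`), FROM (128): `Δx A = −x + Q*((QGQ*)⁻¹(Q(Gx))) + Q*((QGQ*)⁻¹ b) − Q*(a·b)` — NO `D R_S D* G x` TERM** — for the Landau solution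
(`R_S D* A = 0`, `QA = b`) satisfying (128) `Δx A + x ∈ range Q*`: the shape of ✓`Prop7HessRowOfEq111.slot_sol_eq` ∕ ym3-torus-px5's `slot_sol_eq_of_sliceRows` WITHOUT the multiplier summand
(the S10′ row `hmult` has nothing to assert here: ★★OWNER RULING g28-№9, defect №8).  Reason: (128) makes the (130)-reader `𝔊₀ = G − H₀QG`, not `G𝔓* = G − GQ*(QGQ*)⁻¹QG − GDR_SD*G` (3.153).
[cite: Balaban1985Variational, (128)–(130) p.297; Balaban1985BackgroundPropagators, (3.26) p.395, (3.153) p.426] -/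
theorem slot_eq_of_eq128_landau {U₀ : GaugeField (F.P K) 0 (Matrix.specialUnitaryGroup (Fin 2) ℂ)} (hp : PosOnto F n K h c₀ cB a Δx U₀)
    {A x : BondL2K ℂ 3 (periodsT3 F K) c₀ W₂} {b μ : WL2 ℂ (fun _ : PBond (F.P n) 0 => cB) W₂}
    (hL : RS F n K h c₀ cB U₀ (DstarL2 F n K c₀ U₀ A) = 0) (hQ : Qk F n K h c₀ cB U₀ A = b)
    (h128 : Δx U₀ A + x = LinearMap.adjoint (Qk F n K h c₀ cB U₀) μ) :
    Δx U₀ A = -x + LinearMap.adjoint (Qk F n K h c₀ cB U₀) (KinvT F n K h c₀ cB a Δx U₀ (Qk F n K h c₀ cB U₀ (GT F n K h c₀ cB a Δx U₀ x)))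
      + LinearMap.adjoint (Qk F n K h c₀ cB U₀) (KinvT F n K h c₀ cB a Δx U₀ b) - LinearMap.adjoint (Qk F n K h c₀ cB U₀) (((a : ℂ)) • b) := by
  -- `Δ_a A` from (129)–(130): `Δ_a(H₀b − Gx + H₀QGx) = Q*Kb − x + Q*K(QGx)`
  have hA := eq130_of_eq128_landau hp hL h128
  rw [hQ] at hA
  have hΔa : laplaceA F n K h c₀ cB a Δx U₀ A
      = LinearMap.adjoint (Qk F n K h c₀ cB U₀) (KinvT F n K h c₀ cB a Δx U₀ b) - x
        + LinearMap.adjoint (Qk F n K h c₀ cB U₀) (KinvT F n K h c₀ cB a Δx U₀ (Qk F n K h c₀ cB U₀ (GT F n K h c₀ cB a Δx U₀ x))) := by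
    conv_lhs => rw [hA]
    rw [map_sub, map_sub, laplaceA_HT hp, laplaceA_HT hp, laplaceA_GT hp]
    abel
  -- `Δx A = Δ_a A − DR_SD*A − Q*aQA`
  have happ := laplaceA_apply (h := h) (cB := cB) (a := a) (Δx := Δx) U₀ A
  rw [hL, map_zero, add_zero, hQ] at happ
  have key : Δx U₀ A = laplaceA F n K h c₀ cB a Δx U₀ A - LinearMap.adjoint (Qk F n K h c₀ cB U₀) (((a : ℂ)) • b) := eq_sub_of_add_eq happ.symm
  rw [key, hΔa]
  abel

end Summit.QuantumFields.YangMills.Theorems.Prop7Eq130OfEq128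

end
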